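import Summits.BirchSwinnertonDyer.BirchSwinnertonDyer.Theorems.EisensteinPrimesTwistDeformationShapiroEval
import Summits.BirchSwinnertonDyer.BirchSwinnertonDyer.Theorems.EisensteinPrimesTwistDeformationShapiroIterated
import HarnessLib

/-!
# Route `EisensteinPrimes` (rung K5), crux 2 `GoodLatticeBDPValue`, line `halves` v7, stub
# `stub_shapiroBridgePure` (K-Sh), brick E4a: THE BRIDGE `sh = shapiroEval` IS INJECTIVE ON
# `H¹(K_Σ/K, 𝐃)` (helper for stmt-BirchSwinnertonDyer-19032)

Cell `bsd-eis`, seat `bsd-eis-k5-c2` (gen 9). Class-level injectivity of the bridge map of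
`stub_shapiroBridgePure`, `sh : H¹(G_{K,S}, 𝐃) → H¹(Gal(K̄/K̃_∞), M)` (`…ShapiroEval.shapiroEval`,
p533162), for a bijective equivariant coefficient identification `ψ : A ≃+ M` and a topological
generator pair: if `sh ξ = 0` then `ξ = 0`. Proof: unfold `sh [c] = [s ↦ ψ (c(s̄)(0,0))]`
(`shapiroEval_oneCocycleClass`), read a primitive `m ∈ M` of the Shapiro cocycle as the primitive
`ψ⁻¹ m ∈ A` of `h ↦ c(h)(0)(0)` on `Gal(K_S/K̃_∞) = {κ̄₁ = κ̄₂ = 0}` (every such `h` lifts to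
`Gal(K̄/K̃_∞)`), and apply the two-variable Shapiro injectivity
`…ShapiroIterated.twistDeformation_exists_eq_sub_of_apply_zero_zero_eq` (p540271). No Selmer condition
is needed for this half. Theorems only; no definition, no named fact, no instance, no `sorry`.
HONEST FRAMING: closes nothing by itself (`--supports`).
References: [SerreGaloisCohomology1997] I §2.5; [Greenberg2006] Thm. 3 p. 342.
-/

set_option autoImplicit false
set_option linter.dupNamespace false

noncomputable section

open scoped Classical
open NumberField IsDedekindDomain Field PowerSeries Multiplicative
open Literature.NumberTheory.EllipticCurves Literature.NumberTheory.GaloisRepresentations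
  Literature.NumberTheory.IwasawaTheory.Greenberg2006

namespace Summit.BirchSwinnertonDyer.BirchSwinnertonDyer.Theorems.GreenbergFullAtSelmer

variable {K : Type} [Field K] [NumberField K] {S : Set (HeightOneSpectrum (𝓞 K))} {p : ℕ}
  [Fact p.Prime] {𝒪 : Type} [CommRing 𝒪] [TopologicalSpace 𝒪]
  {A : Type} [AddCommGroup A] [Module 𝒪 A] [TopologicalSpace A] [DiscreteTopology A]
  [TopologicalSpace (PowerSeries 𝒪)] [TopologicalSpace (PowerSeries (PowerSeries 𝒪))]
  [IsTopologicalAddGroup (IndModule₂ 𝒪 p A)]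
  [ContinuousSMul (PowerSeries (PowerSeries 𝒪)) (IndModule₂ 𝒪 p A)]
  (hS : ∀ v : HeightOneSpectrum (𝓞 K), ((p : ℕ) : 𝓞 K) ∈ v.asIdeal → v ∈ S)
  (κ₁ κ₂ : ZpExtension K p) (ρ₀ : ContinuousRep (GaloisGroupUnramifiedOutside K S) 𝒪 A)
  {M : Type} [AddCommGroup M] [DistribMulAction (absoluteGaloisGroup K) M] [TopologicalSpace M]
  [DiscreteTopology M]

/-- A primitive of the Shapiro cocycle of `c` on `Gal(K̄/K̃_∞)` gives a primitive of `h ↦ c(h)(0)(0)`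
on `Gal(K_S/K̃_∞) = {κ̄₁ = κ̄₂ = 0} ≤ G_{K,S}` (every such `h` lifts to `pairKer κ₁ κ₂`, and `ψ` is
injective and equivariant). [cite: SerreGaloisCohomology1997, I §2.5] -/
theorem apply_zero_zero_eq_of_shapiroCocycle_eq (ψ : A ≃+ M)
    (hψ : ∀ (σ : absoluteGaloisGroup K) (a : A), ψ (ρ₀ (toUnramifiedQuot K S σ) a) = σ • ψ a)
    (c : contOneCocycles (twistDeformation S hS κ₁ κ₂ ρ₀).toTopRep) {m : M}
    (hm : ∀ s : ZpExtension.pairKer κ₁ κ₂,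
      (shapiroCocycle hS κ₁ κ₂ ρ₀ ψ.toAddMonoidHom hψ c).1 s =
        (discreteTopRep (ZpExtension.pairKer κ₁ κ₂) M).ρ s m - m)
    (h : GaloisGroupUnramifiedOutside K S) (h₁ : κ₁.liftUnramifiedOutside S hS h = 1)
    (h₂ : κ₂.liftUnramifiedOutside S hS h = 1) :
    c.1 h 0 0 = ρ₀ h (ψ.symm m) - ψ.symm m := by
  obtain ⟨s, rfl⟩ := QuotientGroup.mk'_surjective (ramificationSubgroup K S) h
  have hs : s ∈ ZpExtension.pairKer κ₁ κ₂ := ZpExtension.mem_pairKer_iff.mpr ⟨h₁, h₂⟩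
  apply ψ.injective
  rw [map_sub, hψ s (ψ.symm m), AddEquiv.apply_symm_apply]
  exact hm ⟨s, hs⟩

/-- **The bridge is injective on `H¹(K_Σ/K, 𝐃)`**: for a bijective equivariant `ψ : A ≃+ M` and a
topological generator pair `(γ₁, γ₂)`, `shapiroEval ξ = 0 → ξ = 0` (two-variable Shapiro injectivity,
p540271, read on Mathlib's `H¹` through `oneCocycleClass_eq_zero_iff` on both sides).
[cite: Greenberg2006, Thm. 3 p. 342] [cite: SerreGaloisCohomology1997, I §2.5] -/
theorem eq_zero_of_shapiroEval_eq_zero (ψ : A ≃+ M)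
    (hψ : ∀ (σ : absoluteGaloisGroup K) (a : A), ψ (ρ₀ (toUnramifiedQuot K S σ) a) = σ • ψ a)
    {γ₁ γ₂ : absoluteGaloisGroup K} (hpair : ZpExtension.IsTopGeneratorPair κ₁ κ₂ γ₁ γ₂)
    (hA : ∀ a : A, ∃ k : ℕ, p ^ k • a = 0)
    (ξ : (twistDeformation S hS κ₁ κ₂ ρ₀).H 1)
    (h0 : shapiroEval hS κ₁ κ₂ ρ₀ ψ.toAddMonoidHom hψ ξ = 0) : ξ = 0 := by
  obtain ⟨c, rfl⟩ := oneCocycleClass_surjective _ ξ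
  rw [shapiroEval_oneCocycleClass, oneCocycleClass_eq_zero_iff] at h0
  obtain ⟨m, hm⟩ := h0
  have hc : ∀ g h : GaloisGroupUnramifiedOutside K S,
      c.1 (g * h) = c.1 g + twistDeformation S hS κ₁ κ₂ ρ₀ g (c.1 h) := c.2
  obtain ⟨Φ, -, hΦ⟩ := twistDeformation_exists_eq_sub_of_apply_zero_zero_eq hS κ₁ κ₂ ρ₀ hpair hA
    c.1.continuous hc (apply_zero_zero_eq_of_shapiroCocycle_eq hS κ₁ κ₂ ρ₀ ψ hψ c hm)
  exact (oneCocycleClass_eq_zero_iff _ c).mpr ⟨Φ, fun g ↦ hΦ g⟩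

/-- **The bridge is injective** (as a statement about the additive map): `Function.Injective sh`.
[cite: Greenberg2006, Thm. 3 p. 342] -/
theorem shapiroEval_injective (ψ : A ≃+ M)
    (hψ : ∀ (σ : absoluteGaloisGroup K) (a : A), ψ (ρ₀ (toUnramifiedQuot K S σ) a) = σ • ψ a)
    {γ₁ γ₂ : absoluteGaloisGroup K} (hpair : ZpExtension.IsTopGeneratorPair κ₁ κ₂ γ₁ γ₂)
    (hA : ∀ a : A, ∃ k : ℕ, p ^ k • a = 0) :
    Function.Injective (shapiroEval hS κ₁ κ₂ ρ₀ ψ.toAddMonoidHom hψ) :=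
  (injective_iff_map_eq_zero _).mpr
    fun ξ h0 ↦ eq_zero_of_shapiroEval_eq_zero hS κ₁ κ₂ ρ₀ ψ hψ hpair hA ξ h0

end Summit.BirchSwinnertonDyer.BirchSwinnertonDyer.Theorems.GreenbergFullAtSelmer

end
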